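import Summits.Ventures.CertifiedManyBodySolver.Downfold.TppSeamFilling
import HarnessLib

/-!
# The `t''` seam at fixed filling for POINTWISE windows (affine / multilinear / any function of the cell coordinates):
# an S2 enclosure `F θ ≤ e₀(1, θ 1, θ 0, θ 2) ≤ G θ` on the delivered cell becomes, on an object-M box,
# `F(s2Coords p) − C·m ≤ e^M_n(p) ≤ G(s2Coords p) + C·m` (`C = 16/π²` kinematic; `m = max |tpp/t|`)

Venture CertifiedManyBodySolver, cell `pub/hubbard-downfold` (stage S1 ↔ S2 seam), seat hubbard-downfold-mod-1; namespace
`Summit.Ventures.CertifiedManyBodySolver.Downfold`. `TppSeamFilling.lean` (`holdsOn_tiGroundEnergyDensityAt_objectM_of_classBound` /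
`_kinematic` / `_four`) takes a CONSTANT window `[L, R]`. hubbard-box-p2's AFFINE words (`aw_<cell>_affword_Icc`, 2026-08-27) follow the energy
across the box, so the object-M reading should too. Same two ingredients as the constant seam — the Lipschitz step in `t''`
(`abs_tiGroundEnergyDensityAt_tpp_sub_le_of_classBound`, class constant `C` from a bound on `|K₃(σ)|` at the box's fillings) and the identification
at `t'' = 0` (`tiGroundEnergyDensityAt_hubbardTT'T''_zero`) — assembled pointwise:
* `holdsOn_tiGroundEnergyDensityAt_objectM_of_classBound_fun` — generic class constant `C ≥ 0`;
* `holdsOn_tiGroundEnergyDensityAt_objectM_kinematic_fun` — `C = 16/π²` (`kinematic_classBound_of_entry`).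
Instances (affine words on the object-M boxes `boxYBCO7M_M18`, `boxCCOCM_M36`, …) live in the `BoxesWords*` files.
HONEST FRAMING: pure transport lemmas; energy words only; nothing about order, pairing, `T_c` or a phase word. Everything is PROVED; no definition, no `sorry`.
-/

noncomputable section

namespace Summit.Ventures.CertifiedManyBodySolver.Downfold

open NonemptyInterval Literature.MathematicalPhysics.QuantumLattice
  Literature.MathematicalPhysics.QuantumLattice.ThermodynamicLimit Literature.Probability.LatticeModels

/-- **POINTWISE `t''` SEAM, generic class constant.** Box `B` with entries `eU, eS, eSS, eN` (`eU.lo ≥ 0`, `0 < eN.lo`, `eN.hi < 2`), a class bound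
`|K₃(σ)| ≤ C` at every filling of the box, and ANY pointwise enclosure `F θ ≤ e₀(1, θ 1, θ 0, θ 2) ≤ G θ` on the delivered cell: then at every member
`F(s2Coords p) − C·m ≤ e^M_{p n}(1, p tp/t, p tpp/t, p U/t) ≤ G(s2Coords p) + C·m`, `m = max |eSS.lo| |eSS.hi|`. [cite: LiebLoss1993, §8, Theorem 8.2] -/
theorem holdsOn_tiGroundEnergyDensityAt_objectM_of_classBound_fun {B : OneBandBox} {eU eS eSS eN : Entry}
    (hU : B .UOverT = some eU) (hS : B .tpOverT = some eS) (hSS : B .tppOverT = some eSS)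
    (hN : B .filling = some eN) (hU0 : 0 ≤ eU.encl.fst) (hN0 : 0 < eN.encl.fst) (hN2 : eN.encl.snd < 2)
    {C : ℝ} (hC0 : 0 ≤ C)
    (hC : ∀ ρ : ℝ, eN.Mem ρ → ∀ σ : InfVolFermionState 2, σ.IsTranslationInvariant → σ.density = ρ →
      |σ.meanEnergy (axialRange2HoppingFermionInteraction 2 1) 2| ≤ C)
    {F G : (Fin 3 → ℝ) → ℝ}
    (hE : ∀ θ ∈ Set.Icc (s2Lo eU eS eN) (s2Hi eU eS eN),
      F θ ≤ energyDensityTT' 1 (θ 1) (θ 0) (θ 2) ∧ energyDensityTT' 1 (θ 1) (θ 0) (θ 2) ≤ G θ) :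
    HoldsOn (fun p : OneBandCoord → ℝ =>
      F (s2Coords p) - C * ((max |eSS.encl.fst| |eSS.encl.snd| : ℚ) : ℝ) ≤
          (hubbardTT'T''FermionInteraction 1 (p .tpOverT) (p .tppOverT) (p .UOverT)).tiGroundEnergyDensityAt
            2 (p .filling) ∧
        (hubbardTT'T''FermionInteraction 1 (p .tpOverT) (p .tppOverT) (p .UOverT)).tiGroundEnergyDensityAt
            2 (p .filling) ≤
          G (s2Coords p) + C * ((max |eSS.encl.fst| |eSS.encl.snd| : ℚ) : ℝ)) B := by
  intro p hp
  obtain ⟨hu0, hn0, hn2⟩ := mem_sideConditions hU hN hU0 hN0 hN2 hp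
  have hθ := hE (s2Coords p) (s2Coords_mem_Icc hU hS hN hp)
  have h1 : s2Coords p 1 = p .tpOverT := rfl
  have h0 : s2Coords p 0 = p .UOverT := rfl
  have h2 : s2Coords p 2 = p .filling := rfl
  simp only [h1, h0, h2] at hθ
  have hz := tiGroundEnergyDensityAt_hubbardTT'T''_zero 1 (p .tpOverT) hu0 hn0 hn2
  have hL := abs_tiGroundEnergyDensityAt_tpp_sub_le_of_classBound 1 (p .tpOverT) (p .UOverT) (p .filling) hC0
    (hC (p .filling) (hp _ _ hN)) (p .tppOverT) 0
  rw [sub_zero, hz] at hL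
  have hm := Entry.abs_le_of_mem (hp _ _ hSS)
  have hCm : C * |p .tppOverT| ≤ C * ((max |eSS.encl.fst| |eSS.encl.snd| : ℚ) : ℝ) :=
    mul_le_mul_of_nonneg_left hm hC0
  rw [abs_sub_le_iff] at hL
  constructor
  · linarith [hL.1, hL.2, hθ.1]
  · linarith [hL.1, hL.2, hθ.2]

/-- **POINTWISE `t''` SEAM with the KINEMATIC constant `16/π²`.** As above with `C = 16/π²` (`|K₃(σ)| ≤ 16/π²` at every density in `(0, 2)`):
`F(s2Coords p) − (16/π²)·m ≤ e^M_{p n} ≤ G(s2Coords p) + (16/π²)·m` at every member. [cite: LiebLoss1993, §8, Theorem 8.2] -/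
theorem holdsOn_tiGroundEnergyDensityAt_objectM_kinematic_fun {B : OneBandBox} {eU eS eSS eN : Entry}
    (hU : B .UOverT = some eU) (hS : B .tpOverT = some eS) (hSS : B .tppOverT = some eSS)
    (hN : B .filling = some eN) (hU0 : 0 ≤ eU.encl.fst) (hN0 : 0 < eN.encl.fst) (hN2 : eN.encl.snd < 2)
    {F G : (Fin 3 → ℝ) → ℝ}
    (hE : ∀ θ ∈ Set.Icc (s2Lo eU eS eN) (s2Hi eU eS eN),
      F θ ≤ energyDensityTT' 1 (θ 1) (θ 0) (θ 2) ∧ energyDensityTT' 1 (θ 1) (θ 0) (θ 2) ≤ G θ) :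
    HoldsOn (fun p : OneBandCoord → ℝ =>
      F (s2Coords p) - 16 / Real.pi ^ 2 * ((max |eSS.encl.fst| |eSS.encl.snd| : ℚ) : ℝ) ≤
          (hubbardTT'T''FermionInteraction 1 (p .tpOverT) (p .tppOverT) (p .UOverT)).tiGroundEnergyDensityAt
            2 (p .filling) ∧
        (hubbardTT'T''FermionInteraction 1 (p .tpOverT) (p .tppOverT) (p .UOverT)).tiGroundEnergyDensityAt
            2 (p .filling) ≤
          G (s2Coords p) + 16 / Real.pi ^ 2 * ((max |eSS.encl.fst| |eSS.encl.snd| : ℚ) : ℝ)) B :=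
  holdsOn_tiGroundEnergyDensityAt_objectM_of_classBound_fun hU hS hSS hN hU0 hN0 hN2 (by positivity)
    (fun ρ hρ σ hσ hσρ => kinematic_classBound_of_entry hN0 hN2 ρ hρ σ hσ hσρ) hE

end Summit.Ventures.CertifiedManyBodySolver.Downfold

end
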